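import Mathlib.NumberTheory.Padics.PadicNumbers
import Mathlib.RingTheory.AdjoinRoot
import Mathlib.Algebra.Polynomial.Derivative
import Literature.NumberTheory.QuadraticForms.HilbertSymbol
import HarnessLib
import HarnessLib.Audit

/-!
# Cell `bsd-f1-sign2` — ES lens (-es g21, MEMO-es §30.13–§30.14; D-es-83, E29-R2): GM-H «GREEN–MAISTRET'S LOCAL ERROR TERM IS (−1,−1)·(θ, f′(θ)) IN THE CUBIC ALGEBRA»
# (`cubicDisc`, `gmErrorTerm` = GM Def. 2.8, and the three splitting-type rows `GreenMaistretSplitLaw` / `GreenMaistretIrreducibleLaw` / `GreenMaistretOneRootLaw` over `ℚ_[p]`)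

STATEMENTS ONLY, typer -ty g17.  Port asked by -es g21 (D-es-83 «port Sketch30b»), REF-GATED until REF1 g18 §199 (INBOX 2026-08-29T13:18:31Z, «R199a/c for D-es-83»).
Source: `HOME/data-es/g21/lean/Sketch30b.lean` **6f961678b7f9fc08** (70 l., rc 0; -es's `Sketch30b_probe`); REF1's probe `HOME/REF1-data/b199/lean/Probe199.lean` **c1b016bd42d6511f** (farm rc 0 ·
3 sorries · 8 BC7 lemmas).  HOMING as for ES-27/28/30: cell folder `F1Sign2/`, -es's OWN namespace `…Theorems.GreenMaistretErrorTerm` as sketched; imports = the sketch's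
(Mathlib + the tree's elementary `Literature.NumberTheory.QuadraticForms.hilbertSymbol`).  ALL FIVE DECLS VERBATIM (bodies byte-identical to the sketch AND Probe199,
builder-verified); the three rows keep `@[conjecture]` (R199a: theorem-candidates tagged like ES-30a until a Lean proof lands); R199c: rows stay over `ℚ_[p]` / `AdjoinRoot`
(no arbitrary-field generalisation); R199d: the `ℝ` / extension rows are optional, not typed; docstrings verbatim + one REF1-AUDIT §199 and one REF2-PLACEMENT v53 §23/§24/§26
rider each; -es's module docstring below verbatim (its word «CONJECTURE» predates §30.14 / §199: GM-H is now a THEOREM on paper).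
GRADES (REF1-AUDIT §199 D-es-82/82′, evidence `HOME/REF1-data/b199/` SHA16.txt): **GM-H — the §30.14 proof PASSES REF1's line-by-line audit ⟹ THEOREM** (residue computation of
γ = {b,−c}+{−2L,Δ}+{L,−b}+{−1,−1} − cor{θ,f′(θ)} along c = 0, Δ = 0, b = 0, L = 0; ramification input π*Δ = disc(g)·q²; purity + Br(𝔸³_ℚ) = Br(ℚ); evaluation at (x−1)(x−2)(x−4);
degenerate branch as the K₂/2 limit; REF1 second engine `gmh_check.py` 0 violations incl. p = 2 / ramified / ∞; REF2's closed form 86 418/86 418); **all three rows SURVIVE —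
THEOREM-grade; KILLED none**; R199b: cite purity ([cite: Cesnavicius2019] / [cite: BlochOgus1974]) + [cite: AuslanderGoldman1960], state π*Δ = disc(g)q²; R199e: no
«computer-assisted» needed.  REF2-PLACEMENT v53 §23/§24/§26 (register FINAL b029f6daca38610c): [cite: GreenMaistret2022, Thm. 2.11] is a theorem for all char-0 local fields, so
GM-H ⟺ a CURVE-FREE identity of Hilbert symbols «(b,−c)(−2L,Δ_f)(L,−b)(−1,−1) = (b,c)(b,−L)(2m,3)(2mL,−Δ_f)» (D-es-83′), which «= (θ, f′(θ))_{𝒦[θ]/(f)} by ROSSET–TATE»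
([cite: RossetTate1983]; [cite: GilleSzamuely2006, Thm. 7.4.9, Lemma 7.4.6, Cor. 7.4.7]) + two Steinberg relations on the generic branch b·L·m ≠ 0 (m = 3b − a²) — REF2's
independent derivation sketch §24 (D-es-81 FINAL).  Beyond-print (REF1's side): YES for «H = (−1,−1)·cor(θ, f′(θ))» as a statement not located in print (not BSD; placement REF2 §26).
PARTITION none.  BSD is not proved.  bears_on: stmt-BirchSwinnertonDyer-23715.

## -es's module docstring of `Sketch30b.lean` (verbatim)

# Green–Maistret's local error term as a symbol in the cubic algebra (-es g21, §30.13; E29-R2)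

For a local field `𝒦` of characteristic `0` and a separable monic cubic `f = X³ + aX² + bX + c`,
`c ≠ 0`, Green–Maistret (Proc. R. Soc. A 478 (2022), arXiv:2110.06718, Def. 2.8 / Thm. 2.11) define
`𝔈 := (b,−c)(−2L,Δ_f)(L,−b)` (`L = ab − 9c`; degenerate branch `(−c,−1)(2c,Δ_f)` when `b = 0` or
`L = 0`) and prove `w(E/𝒦)·w(Jac E′/𝒦) = λ_{f,𝒦}·𝔈` for `E : y² = f(x)`, `E′ : y² = x f(x)`.
CONJECTURE (GM-H, this seat; engine GM30: 4 131 / 4 131 local instances over `ℚ_p`, `p` odd, all tame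
splitting types, `ℚ₂` split, and `ℝ`): `𝔈 = (−1,−1)_𝒦 · (θ, f′(θ))_{𝒦[θ]/(f)}`, the symbol in the cubic
algebra being the product over its factor fields.  Stated below over `ℚ_[p]` in the three splitting
cases, with the tree's elementary Hilbert symbol `Literature.NumberTheory.QuadraticForms.hilbertSymbol`.
-/

set_option linter.dupNamespace false

namespace Summit.BirchSwinnertonDyer.BirchSwinnertonDyer.Theorems.GreenMaistretErrorTerm

open Polynomial Literature.NumberTheory.QuadraticForms

/-- Discriminant of the monic cubic `X³ + aX² + bX + c`.
REF1-AUDIT §199 BC7: `cubicDisc (−S₁) S₂ (−S₃) = ∏_{i<j}(αᵢ − αⱼ)²` by `ring` (`bc7_cubicDisc_split`) ⟹ the symbol `(−2L, Δ)` is `1` in the split row. -/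
def cubicDisc {F : Type*} [Field F] (a b c : F) : F :=
  18*a*b*c - 4*a^3*c + a^2*b^2 - 4*b^3 - 27*c^2

open Classical in
/-- Green–Maistret's local error term `𝔈(f, F)` (Def. 2.8) for `f = X³ + aX² + bX + c`.
REF1-AUDIT §199: = [cite: GreenMaistret2022, Def. 2.8] VERBATIM (corpus p. 5), degenerate `else` branch included; GM Rem. 2.10 re-checked by `ring`. -/
noncomputable def gmErrorTerm (F : Type*) [Field F] (a b c : F) : ℤ :=
  if b ≠ 0 ∧ a*b - 9*c ≠ 0 then
    hilbertSymbol F b (-c) * hilbertSymbol F (-2*(a*b - 9*c)) (cubicDisc a b c)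
      * hilbertSymbol F (a*b - 9*c) (-b)
  else hilbertSymbol F (-c) (-1) * hilbertSymbol F (2*c) (cubicDisc a b c)

/-- GM-H, SPLIT CASE over `ℚ_[p]`: for pairwise distinct non-zero `α₁ α₂ α₃` and
`f = ∏ (X − αᵢ)` (so `a = −S₁`, `b = S₂`, `c = −α₁α₂α₃`), using the Steinberg reduction
`(θ, f′(θ))_A = ∏_{i<j} (αᵢ, αⱼ)`:  `𝔈 = (−1,−1)·(α₁,α₂)(α₁,α₃)(α₂,α₃)`.
REF1-AUDIT §199 (D-es-82/82′): **SURVIVES — THEOREM-grade** (GM-H «𝔈 = (−1,−1)·cor(θ, f′(θ))», MEMO-es §30.14: the proof PASSES REF1's line-by-line audit — residues of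
`γ = {b,−c}+{−2L,Δ}+{L,−b}+{−1,−1} − cor{θ, f′(θ)}` along `c = 0`, `Δ = 0`, `b = 0`, `L = 0` all re-derived; ramification input `π*Δ = disc(g)·q²` (`f = (x−θ)g`, `g(θ) = f′(θ) = q`)
⟹ `e = 2` along `{q = 0}`; purity + `Br(𝔸³_ℚ) = Br(ℚ)` ⟹ constant; evaluation at `(x−1)(x−2)(x−4)` ⟹ `γ = 0`; degenerate branch = GM's `(−c,−1)(2c,Δ)` as the limit in `K₂/2`;
REF1 second engine `gmh_check.py` (exact rational symbols): split law AS TYPED incl. both degenerate branches at `p = 2` / ramified `p` / `∞`: 2 746 + 558 + 288 cubics, 0 violations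
(p = 2: 3 592/3 592); REF2's closed form cross-validated 86 418/86 418).  R199a: ported as a theorem-candidate (`@[conjecture]` like ES-30a until a Lean proof lands); R199b: the
proof's inputs to cite are PURITY for the Brauer group ([cite: Cesnavicius2019] / [cite: BlochOgus1974]) + [cite: AuslanderGoldman1960] (`Br` of a regular ring injects), with
`π*Δ = disc(g)q²` stated; R199c: rows stay over `ℚ_[p]` / `AdjoinRoot` (a product of `±1`'s is not a Brauer identity over an arbitrary field — no generalisation); R199e: no
«computer-assisted» label needed.  REF2-PLACEMENT v53 §23/§24/§26 (D-es-81, register FINAL b029f6daca38610c): GM Thm. 2.11 is a THEOREM for all char-0 local fields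
([cite: GreenMaistret2022, Thm. 2.11]), so GM-H ⟺ a CURVE-FREE identity of Hilbert symbols, `= (θ, f′(θ))_{𝒦[θ]/(f)}` by ROSSET–TATE ([cite: RossetTate1983];
[cite: GilleSzamuely2006, Thm. 7.4.9, Lemma 7.4.6, Cor. 7.4.7]) + two Steinberg relations on the generic branch `b·L·m ≠ 0` — REF2's derivation sketch §24; Steinberg
reduction in the split case `(θ, f′(θ))_A = ∏_{i<j}(αᵢ, αⱼ)` as in the docstring.  Beyond-print on REF1's side: YES for «H = (−1,−1)·cor(θ, f′(θ))» as a located statement (not BSD). -/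
@[conjecture] def GreenMaistretSplitLaw : Prop :=
  ∀ (p : ℕ) [Fact p.Prime] (α₁ α₂ α₃ : ℚ_[p]),
    α₁ ≠ 0 → α₂ ≠ 0 → α₃ ≠ 0 → α₁ ≠ α₂ → α₁ ≠ α₃ → α₂ ≠ α₃ →
    gmErrorTerm ℚ_[p] (-(α₁ + α₂ + α₃)) (α₁*α₂ + α₁*α₃ + α₂*α₃) (-(α₁*α₂*α₃))
      = hilbertSymbol ℚ_[p] (-1) (-1)
        * (hilbertSymbol ℚ_[p] α₁ α₂ * hilbertSymbol ℚ_[p] α₁ α₃ * hilbertSymbol ℚ_[p] α₂ α₃)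

/-- GM-H, IRREDUCIBLE CASE over `ℚ_[p]`: `f` monic irreducible cubic with `f(0) ≠ 0`,
`A = ℚ_[p][θ]/(f)` a field: `𝔈 = (−1,−1)_{ℚ_p} · (θ, f′(θ))_A`.
REF1-AUDIT §199: **SURVIVES — THEOREM-grade** (same proof; REF1 engine: irreducible-mod-`p` rows 31 725/0; `bc7_root_ne_zero`: `f(0) ≠ 0 ⟹` the root is a unit, so no zero symbol
entry under the binders).  R199a/c as above.  REF2-PLACEMENT v53 §23/§24: the cubic-algebra symbol `(θ, f′(θ))_{ℚ_p[θ]/(f)}` IS the Rosset–Tate transfer of `{θ, f′(θ)}`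
([cite: RossetTate1983]; [cite: GilleSzamuely2006, Thm. 7.4.9]); D-es-83′ wording «= (θ, f′(θ))_{𝒦[θ]/(f)} by Rosset–Tate». -/
@[conjecture] def GreenMaistretIrreducibleLaw : Prop :=
  ∀ (p : ℕ) [Fact p.Prime] (f : Polynomial ℚ_[p]) [Fact (Irreducible f)],
    f.Monic → f.natDegree = 3 → f.coeff 0 ≠ 0 →
    gmErrorTerm ℚ_[p] (f.coeff 2) (f.coeff 1) (f.coeff 0)
      = hilbertSymbol ℚ_[p] (-1) (-1)
        * hilbertSymbol (AdjoinRoot f) (AdjoinRoot.root f) (AdjoinRoot.mk f (derivative f))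

/-- GM-H, ONE-ROOT CASE over `ℚ_[p]`: `f = (X − r)·g` with `g` monic irreducible quadratic,
`r ≠ 0`, `g(0) ≠ 0`, `g(r) ≠ 0`; `A = ℚ_[p] × ℚ_[p][θ]/(g)`:
`𝔈 = (−1,−1) · (r, f′(r))_{ℚ_p} · (θ, f′(θ))_{ℚ_p[θ]/(g)}`.
REF1-AUDIT §199: **SURVIVES — THEOREM-grade** (REF1 engine: one-root-mod-`p` rows 43 275/0; `bc7_deriv_at_root`: `f′(r) = g(r)` for `f = (X − r)·g`, so the rational factor's
symbol is `(r, g(r))`).  R199a/c as above; R199d: the `ℝ` / extension-field rows are optional and not typed.  REF2-PLACEMENT v53 §23/§24/§26 as above. -/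
@[conjecture] def GreenMaistretOneRootLaw : Prop :=
  ∀ (p : ℕ) [Fact p.Prime] (r : ℚ_[p]) (g : Polynomial ℚ_[p]) [Fact (Irreducible g)],
    g.Monic → g.natDegree = 2 → r ≠ 0 → g.coeff 0 ≠ 0 → g.eval r ≠ 0 →
    let f : Polynomial ℚ_[p] := (X - C r) * g
    gmErrorTerm ℚ_[p] (f.coeff 2) (f.coeff 1) (f.coeff 0)
      = hilbertSymbol ℚ_[p] (-1) (-1)
        * (hilbertSymbol ℚ_[p] r ((derivative f).eval r)
           * hilbertSymbol (AdjoinRoot g) (AdjoinRoot.root g) (AdjoinRoot.mk g (derivative f)))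

end Summit.BirchSwinnertonDyer.BirchSwinnertonDyer.Theorems.GreenMaistretErrorTerm
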